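import Summits.QuantumFields.BalabanUV.T4Continuum.Support.NE7HintOfPlaqGradSU2
import Summits.QuantumFields.BalabanUV.T4Continuum.Support.NE7PlaqGradDictionaryLocal
import Literature.NumberTheory.Sieve.CoprimeSquarefreeSumsBounds
import HarnessLib

/-!
# NE7 — (8)∃ FROM THE REGULARITY LETTERS OF [B11] Thm 1 (9), READ LITERALLY AND LOCALLY, SU(2)∕U(2) on T⁴, `L = 2` (F295): around every point `q` a unitary
# gauge `u` and a potential `A` with `U^{u} = e^{A}` on the sup-ball of radius 2 about `q` and `|A| ≤ c₀t∕M`, `|∇A| ≤ c₁t∕M²`, `|∇∇A| ≤ c₂t∕M³` there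
# (`t = r + 4(e^β − 1) + ε`) ⟹ (PG) with `C_g = 2c₂ + 32c₀c₁ + 4c₀` ⟹ (8)∃ (F291)

Cell `pub-balaban`, rung (B)+1 sub-cell t4, lineage `b2b-balaban-t4-ne7-p1` (CRUX PROVER NE7 #1 = OWNER of row NE7), generation 91; memo
`t4/b2b-balaban-t4-ne7-p1-g91/COVER-OBSTRUCTION.md` §5.  Over F291 `NE7HintOfPlaqGradSU2.hint_of_plaqGrad_SU2` ((8)∃ ⇐ (PG) ∧ hleaves ∧ lines), F294
`NE7PlaqGradDictionaryLocal.norm_plaqGradDir_le_local` (the pointwise dictionary) and F289 `NE7AxialGaugeGradient.norm_plaqGradDir_gaugeAct` (gauge invariance).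

WHY.  [Balaban1985Variational] Thm 1 (9) (β₀ = 1) gives, for the constrained minimiser and every admissible cube, a gauge in which `|A|`, `|∇A|` and the
Lipschitz constant of `∇A` are bounded at the scales `M^{−1}`, `M^{−2}`, `M^{−3}` (times `B·M_c·ε₁`).  This file states that datum LOCALLY and LITERALLY — a gauge on
the sup-ball of radius 2 about each point with the three letters — and shows it implies (PG) (plaquette gradients `≤ (2c₂ + 32c₀c₁ + 4c₀)·t∕M³`; the exponential
factors `e^{4ρ} − 1 ≤ 8ρ`, `e^{ρ} − 1 ≤ 2ρ` need `4ρ ≤ 1`, which the regime `ε ≤ 1∕(5(c₀+1))`, `β ≤ 1∕(32(c₀+1))` provides), hence (8)∃ by F291.  So the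
NE7-specific bill of route 1's END is now the printed shape of (9) — for OUR tangent-critical admissible configurations (uniqueness of the critical orbit in the
class is part of what the supplier must bring: [B11] Thm 1 (ii) ∕ the lineage's `NE7ConvOneStepCriticalUnique`).
WHAT ([folklore] composition + arithmetic; 0 def, 0 sorry).  §1 arithmetic (`plaqGrad_letters_bound`; `e^y − 1 ≤ 2y` is the tree's `SquarefreeSums.exp_sub_one_le_two_mul`); §2 `plaqGrad_of_regLetters` ((PG) at one
`(q, τ, κ, μ)` from the local gauge); §3 **`hint_of_regLetters_SU2`**: ∀ `c₀ c₁ c₂ ≥ 0` ∃ `ℓ ≥ 1`, `ε₀ > 0` ∀ `0 < ε ≤ ε₀` ∃ `β₀ > 0` ∀ `0 < β ≤ β₀` ∀ `N ≥ 1`: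
route Π's two lines ∧ (REG9: the local gauges with the three letters, on the `(4ℓ+64)`-fold cover) ∧ hleaves ⟹ (8)∃.
HONEST FRAMING (page 1): (REG9) is [B11] Thm 1 (9) TYPE, asserted for nothing; hleaves ([B11] Prop 2 TYPE) likewise; nothing of Bałaban's asserted as an axiom; NE7
NOT PROVED unconditionally; spine 0∕9; finite T⁴ rung (B)+1 — NOT infinite volume, NOT mass gap, NOT `BetaPertH`, NOT Clay.  Continuum YM on T⁴ ⇐ BetaPertH ∧
nine spine estimates (0/9 proved); BetaPertH ⇐ (D1) ∧ (D4) ∧ CAP+tail; G-an2-4 gates asym, D1 and NE2/3/4.  No `sorry`; axioms ⊆ {propext, Classical.choice,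
Quot.sound}.
-/

set_option autoImplicit false

open scoped BigOperators Matrix Matrix.Norms.L2Operator Topology
open NormedSpace Finset Set Filter

namespace Summit.QuantumFields.BalabanUV.T4Continuum.NE7HintOfRegLettersSU2

open Literature.MathematicalPhysics.QuantumFieldTheory.Balaban1983to89
open B7Prop1Explicit B7Prop2Explicit MatrixLog UnitaryModel
open B4TorusKernel.MultiPeriod (torusSupNorm)
open T4AveragingDeficitWall (Ad IsUnitaryCfg IsSkewDir SmallField vary curl curlSq dirSq dirL1)
open T4AveragingDeficitWallBoundary (IsPeriodicCfg periodBox)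
open AveragingDeficitPeriodicCounting (IsPeriodicDir)
open AveragingDeficitMultiLevelPrep (LevelSmall tower TangentIter)
open BlockAverageVaryHolo (nbRad)
open MinimalActionLevels (perWin)
open MinimalActionSandwich (IsMinimiser admissible)
open MinimalActionRate (sfClass)
open NE3HessForm (dAction)
open NE3SlicePoincareBudgetLine (CPLine)
open NE3TangentCovariantTower (dirIter)
open NE3DecomposedRepOfLinearNormalPart (ResidualSliceRepT)
open NE3QbarIterCovLiftPrep (cruxC)
open NE3SmoothRightInverseW (rightInvW)
open NE3RightInverseSolveLetters (thetaLoc)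
open NE3RightInverseL2Letter (l2C)
open NE3HatInvCurlLetters (curl2C curl1C)
open NE3EnergyShapes (IsUnitarySite)
open BlockAveragePushDirSplit (flat)
open NE7GradientCurrency (norm_exp_sub_one_le)
open NE3AxialGaugeLadder (smallField_gaugeAct)
open NE7AxialGaugeGradient (norm_plaqGradDir_gaugeAct)
open NE7PlaqGradDictionaryLocal (norm_plaqGradDir_le_local)
open NE7HintOfPlaqGradSU2 (hint_of_plaqGrad_SU2)
open Literature.NumberTheory.Sieve.SquarefreeSums (exp_sub_one_le_two_mul)

noncomputable section

variable {n : Type*} [Fintype n] [DecidableEq n]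

/-! ## §1 Arithmetic -/

/-- The letters bound: with `ρ = c₀t∕M`, `a₁ = c₁t∕M²`, `a₂ = c₂t∕M³`, `x = r∕M²`, `4ρ ≤ 1`, `0 ≤ r ≤ t ≤ 1`, `M ≥ 1`:
`2a₂ + 4(e^{4ρ} − 1)a₁ + 2(e^{ρ} − 1)x ≤ (2c₂ + 32c₀c₁ + 4c₀)·t∕M³`. [folklore] -/
theorem plaqGrad_letters_bound {M r t c₀ c₁ c₂ : ℝ} (hM : 1 ≤ M) (hc₀ : 0 ≤ c₀) (hc₁ : 0 ≤ c₁) (hr0 : 0 ≤ r) (hrt : r ≤ t) (ht1 : t ≤ 1)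
    (hρ : 4 * (c₀ * t / M) ≤ 1) :
    2 * (c₂ * t / M ^ 3) + 4 * (Real.exp (4 * (c₀ * t / M)) - 1) * (c₁ * t / M ^ 2) + 2 * (Real.exp (c₀ * t / M) - 1) * (r / M ^ 2)
      ≤ (2 * c₂ + 32 * c₀ * c₁ + 4 * c₀) * t / M ^ 3 := by
  have hM0 : 0 < M := by linarith
  have ht0 : 0 ≤ t := hr0.trans hrt
  have hρ0 : 0 ≤ c₀ * t / M := by positivity
  have e1 : Real.exp (4 * (c₀ * t / M)) - 1 ≤ 2 * (4 * (c₀ * t / M)) := exp_sub_one_le_two_mul (by positivity) hρ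
  have e2 : Real.exp (c₀ * t / M) - 1 ≤ 2 * (c₀ * t / M) := exp_sub_one_le_two_mul hρ0 (by linarith)
  have h1 : 4 * (Real.exp (4 * (c₀ * t / M)) - 1) * (c₁ * t / M ^ 2) ≤ 4 * (2 * (4 * (c₀ * t / M))) * (c₁ * t / M ^ 2) :=
    mul_le_mul_of_nonneg_right (mul_le_mul_of_nonneg_left e1 (by norm_num)) (by positivity)
  have h2 : 2 * (Real.exp (c₀ * t / M) - 1) * (r / M ^ 2) ≤ 2 * (2 * (c₀ * t / M)) * (r / M ^ 2) :=
    mul_le_mul_of_nonneg_right (mul_le_mul_of_nonneg_left e2 (by norm_num)) (by positivity)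
  have h3 : 4 * (2 * (4 * (c₀ * t / M))) * (c₁ * t / M ^ 2) = 32 * c₀ * c₁ * (t * t) / M ^ 3 := by field_simp; try ring
  have h4 : 2 * (2 * (c₀ * t / M)) * (r / M ^ 2) = 4 * c₀ * (t * r) / M ^ 3 := by field_simp; try ring
  have h5 : 32 * c₀ * c₁ * (t * t) / M ^ 3 ≤ 32 * c₀ * c₁ * t / M ^ 3 := by
    apply div_le_div_of_nonneg_right _ (by positivity)
    have : t * t ≤ t := by nlinarith
    have : 0 ≤ 32 * c₀ * c₁ := by positivity
    nlinarith
  have h6 : 4 * c₀ * (t * r) / M ^ 3 ≤ 4 * c₀ * t / M ^ 3 := by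
    apply div_le_div_of_nonneg_right _ (by positivity)
    have : t * r ≤ t := by nlinarith
    nlinarith
  have h7 : (2 * c₂ + 32 * c₀ * c₁ + 4 * c₀) * t / M ^ 3 = 2 * (c₂ * t / M ^ 3) + 32 * c₀ * c₁ * t / M ^ 3 + 4 * c₀ * t / M ^ 3 := by ring
  rw [h7]; rw [h3] at h1; rw [h4] at h2
  linarith

/-! ## §2 (PG) at one bond from a local gauge with the three letters -/

/-- `|e_a(i)| ≤ 1`. [folklore] -/
theorem abs_e_le_one (a i : Fin 4) : |(e a : Site 4) i| ≤ 1 := by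
  rw [e_apply]; split_ifs <;> simp

/-- The points used by the dictionary lie within sup-distance `2` of `q`. [folklore] -/
theorem near_of_step (q : Site 4) (a : Fin 4) : ∀ i : Fin 4, |(q + e a) i - q i| ≤ 2 := fun i => by
  rw [show (q + e a) i - q i = (e a : Site 4) i by simp]
  exact (abs_e_le_one a i).trans (by norm_num)

/-- … and so do the points two steps away. [folklore] -/
theorem near_of_two_steps (q : Site 4) (a b : Fin 4) : ∀ i : Fin 4, |(q + e a + e b) i - q i| ≤ 2 := fun i => by
  rw [show (q + e a + e b) i - q i = (e a : Site 4) i + (e b : Site 4) i by simp; ring]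
  exact (abs_add_le _ _).trans (by linarith [abs_e_le_one a i, abs_e_le_one b i])

/-- `q` itself. [folklore] -/
theorem near_self (q : Site 4) : ∀ i : Fin 4, |q i - q i| ≤ 2 := fun i => by simp

set_option maxHeartbeats 400000 in
/-- **(PG) AT ONE BOND FROM THE LOCAL LETTERS.**  For unitary `U` with `SmallField U x`, a unitary gauge `u` and a potential `A` with `U^{u}(y, ν) = e^{A(y,ν)}` for
`|y − q|_∞ ≤ 2`, letters `‖A‖ ≤ ρ`, `‖∇A‖ ≤ a₁`, `‖∇∇A‖ ≤ a₂` there: `‖Ad_{U(q,τ)}U(∂p_{κμ}(q+e_τ)) − U(∂p_{κμ}(q))‖ ≤ 2a₂ + 4(e^{4ρ} − 1)a₁ + 2(e^{ρ} − 1)x`.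
[folklore] -/
theorem plaqGrad_of_regLetters [Nonempty n] {U : Site 4 → Fin 4 → (Matrix n n ℂ)ˣ} (hUu : IsUnitaryCfg U) {x : ℝ} (hUx : SmallField U x)
    {u : Site 4 → (Matrix n n ℂ)ˣ} (hu : ∀ z, u z ∈ unitaryUnits (Matrix n n ℂ)) {A : Site 4 → Fin 4 → Matrix n n ℂ} (q : Site 4)
    (hUA : ∀ (y : Site 4) (ν : Fin 4), (∀ i : Fin 4, |y i - q i| ≤ 2) → gaugeAct u U y ν = expUnit (A y ν))
    {ρ a₁ a₂ : ℝ}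
    (hA0 : ∀ (y : Site 4) (ν : Fin 4), (∀ i : Fin 4, |y i - q i| ≤ 2) → ‖A y ν‖ ≤ ρ)
    (hA1 : ∀ (y : Site 4) (ν τ : Fin 4), (∀ i : Fin 4, |y i - q i| ≤ 2) → ‖A (y + e τ) ν - A y ν‖ ≤ a₁)
    (hA2 : ∀ (y : Site 4) (ν τ σ : Fin 4), (∀ i : Fin 4, |y i - q i| ≤ 2) →
      ‖(A (y + e σ + e τ) ν - A (y + e σ) ν) - (A (y + e τ) ν - A y ν)‖ ≤ a₂)
    (τ κ μ : Fin 4) (hκμ : κ ≠ μ) :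
    ‖Ad (U q τ) ((hol U (q + e τ) (plaqWord κ μ) : (Matrix n n ℂ)ˣ) : Matrix n n ℂ) - ((hol U q (plaqWord κ μ) : (Matrix n n ℂ)ˣ) : Matrix n n ℂ)‖
      ≤ 2 * a₂ + 4 * (Real.exp (4 * ρ) - 1) * a₁ + 2 * (Real.exp ρ - 1) * x := by
  have hWu : IsUnitaryCfg (gaugeAct u U) := fun z ν =>
    (unitaryUnits _).mul_mem ((unitaryUnits _).mul_mem (hu z) (hUu z ν)) ((unitaryUnits _).inv_mem (hu _))
  have hWx : SmallField (gaugeAct u U) x := smallField_gaugeAct hu hUx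
  rw [← norm_plaqGradDir_gaugeAct hu q τ μ κ]
  have h0 := near_self q
  have hs := near_of_step q
  have hss := near_of_two_steps q
  refine norm_plaqGradDir_le_local hWu A q τ κ μ (hUA q κ h0) (hUA (q + e κ) μ (hs κ)) (hUA (q + e μ) κ (hs μ)) (hUA q μ h0)
    (hUA (q + e τ) κ (hs τ)) (hUA (q + e τ + e κ) μ (hss τ κ)) (hUA (q + e τ + e μ) κ (hss τ μ)) (hUA (q + e τ) μ (hs τ))
    ⟨hA0 q κ h0, hA0 (q + e κ) μ (hs κ), hA0 (q + e μ) κ (hs μ), hA0 q μ h0, hA0 (q + e τ) κ (hs τ), hA0 (q + e τ + e κ) μ (hss τ κ),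
      hA0 (q + e τ + e μ) κ (hss τ μ), hA0 (q + e τ) μ (hs τ)⟩
    ⟨hA1 q κ τ h0, by rw [show q + e τ + e κ = q + e κ + e τ by abel]; exact hA1 (q + e κ) μ τ (hs κ),
      by rw [show q + e τ + e μ = q + e μ + e τ by abel]; exact hA1 (q + e μ) κ τ (hs μ), hA1 q μ τ h0⟩
    ⟨hA2 q κ τ μ h0, hA2 q μ τ κ h0⟩ ?_ (hWx (q + e τ) κ μ hκμ)
  rw [hUA q τ h0, val_expUnit]
  exact norm_exp_sub_one_le (hA0 q τ h0)

/-! ## §3 (8)∃ from the regularity letters -/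

set_option maxHeartbeats 800000 in
/-- **F295 — (8)∃ FROM THE REGULARITY LETTERS OF [B11] Thm 1 (9), SU(2)∕U(2) on T⁴, `L = 2`.**  For all `c₀, c₁, c₂ ≥ 0` there are `ℓ ≥ 1`, `ε₀ > 0` and, for every
`0 < ε ≤ ε₀`, a `β₀ > 0` such that for `0 < β ≤ β₀` and every `N ≥ 1`: IF route Π's two `k`-free lines, (REG9) — for every tangent-critical admissible `U` of the
class on the `(4ℓ+64)`-fold cover with `SmallField U (r∕M²)`, `r ≤ ε∕4`, and every point `q`, a unitary gauge `u` and a potential `A` with `U^{u} = e^{A}` on the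
sup-ball of radius `2` about `q` and `‖A‖ ≤ c₀t∕M`, `‖∇A‖ ≤ c₁t∕M²`, `‖∇∇A‖ ≤ c₂t∕M³` there (`t = r + 4(e^β−1) + ε`, `M = 2^{k+1}`) — and row NE3's `hleaves`
hold, THEN for some `δ_V > 0`, over `{V | unitary, N-periodic, SmallField V δ_V}`, at every level some constrained minimiser over `sfClass 4 2 N ε` is
`SmallField U a` with `0 ≤ a < ε∕(2^k)²`. [folklore] -/
theorem hint_of_regLetters_SU2 [Nonempty n] (hn : Fintype.card n = 2) {c₀ c₁ c₂ : ℝ} (hc₀ : 0 ≤ c₀) (hc₁ : 0 ≤ c₁) (hc₂ : 0 ≤ c₂) :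
    ∃ ℓ : ℕ, 1 ≤ ℓ ∧ ∃ ε₀ : ℝ, 0 < ε₀ ∧ ∀ ε : ℝ, 0 < ε → ε ≤ ε₀ → ∃ β₀ : ℝ, 0 < β₀ ∧ ∀ β : ℝ, 0 < β → β ≤ β₀ →
    ∀ (N : ℕ) [NeZero N] (C₂ αh Ch νh κh : ℝ), 1 ≤ N →
    0 ≤ C₂ → 0 ≤ αh → αh ≤ 1 → 0 ≤ Ch →
    νh = 2 * Real.sqrt (l2C 4 2 / (1 - thetaLoc 4 2 * ε) ^ 2 + curl2C 4 2 / (1 - thetaLoc 4 2 * ε) ^ 2) * C₂ * Ch * αh →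
    κh = 4 * (curl1C 4 2 / (1 - thetaLoc 4 2 * ε)) * C₂ * Ch ^ 2 * ε →
    νh < 1 →
    2 * (κh / (1 - νh) ^ 2) < ((((1 / 2 - (νh / (1 - νh)) ^ 2) / (2 * (1 + (CPLine 4 2 2 (1 / 10 ^ 17) (1 / 10 ^ 53) + 1))) - (νh / (1 - νh)) ^ 2) / 2 - 576 * ((4 : ℕ) : ℝ) * (αh ^ 2 * Real.exp (2 * αh))) / (Fintype.card n : ℝ) - 28 * ((4 : ℕ) : ℝ) * (ε + 7 * αh ^ 2)) →
    -- (REG9): the local gauges with the three letters of [B11] Thm 1 (9), on the `(4ℓ+64)`-fold cover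
    (∀ D : Site 4 → Fin 4 → (Matrix n n ℂ)ˣ, IsUnitaryCfg D → IsPeriodicCfg D ((N * (4 * ℓ + 64)) : ℤ) → SmallField D (4 * (Real.exp β - 1)) →
      ∀ (k : ℕ), ∀ U ∈ admissible (sfClass 4 2 (N * (4 * ℓ + 64)) ε) 2 (k + 1) D,
      (∀ φ : Site 4 → Fin 4 → Matrix n n ℂ, IsSkewDir φ → IsPeriodicDir φ (((N * (4 * ℓ + 64)) * 2 ^ (k + 1) : ℕ) : ℤ) → TangentIter 2 k U φ →
        dAction U φ (perWin 4 ((N * (4 * ℓ + 64)) * 2 ^ (k + 1))) = 0) →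
      ∀ r : ℝ, 0 ≤ r → r ≤ (1 / ((2 : ℕ) : ℝ) ^ 2 * ε) → SmallField U (r / (((2 : ℕ) : ℝ) ^ (k + 1)) ^ 2) →
      ∀ q : Site 4, ∃ (u : Site 4 → (Matrix n n ℂ)ˣ) (A : Site 4 → Fin 4 → Matrix n n ℂ),
        (∀ z : Site 4, u z ∈ unitaryUnits (Matrix n n ℂ)) ∧
        (∀ (y : Site 4) (ν : Fin 4), (∀ i : Fin 4, |y i - q i| ≤ 2) → gaugeAct u U y ν = expUnit (A y ν)) ∧
        (∀ (y : Site 4) (ν : Fin 4), (∀ i : Fin 4, |y i - q i| ≤ 2) → ‖A y ν‖ ≤ c₀ * (r + 4 * (Real.exp β - 1) + ε) / (((2 : ℕ) : ℝ) ^ (k + 1))) ∧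
        (∀ (y : Site 4) (ν τ : Fin 4), (∀ i : Fin 4, |y i - q i| ≤ 2) → ‖A (y + e τ) ν - A y ν‖ ≤ c₁ * (r + 4 * (Real.exp β - 1) + ε) / (((2 : ℕ) : ℝ) ^ (k + 1)) ^ 2) ∧
        (∀ (y : Site 4) (ν τ σ : Fin 4), (∀ i : Fin 4, |y i - q i| ≤ 2) →
          ‖(A (y + e σ + e τ) ν - A (y + e σ) ν) - (A (y + e τ) ν - A y ν)‖ ≤ c₂ * (r + 4 * (Real.exp β - 1) + ε) / (((2 : ℕ) : ℝ) ^ (k + 1)) ^ 3)) →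
    -- ROW NE3's PER-PAIR BINDER on the data class (F31's `hleaves`)
    (∀ D : Site 4 → Fin 4 → (Matrix n n ℂ)ˣ, IsUnitaryCfg D → IsPeriodicCfg D (N : ℤ) → SmallField D (4 * (Real.exp β - 1)) → ∀ (k : ℕ), ∀ Us ∈ admissible (sfClass 4 2 N ε) 2 (k + 1) D, SmallField Us ((1 / ((2 : ℕ) : ℝ) ^ 2 * ε / 2) / (((2 : ℕ) : ℝ) ^ (k + 1)) ^ 2) → (∀ φ : Site 4 → Fin 4 → Matrix n n ℂ, IsSkewDir φ → IsPeriodicDir φ ((N * 2 ^ (k + 1) : ℕ) : ℤ) → TangentIter 2 k Us φ → dAction Us φ (perWin 4 (N * 2 ^ (k + 1))) = 0) → ∀ U' ∈ admissible (sfClass 4 2 N ε) 2 (k + 1) D, ∃ (u : Site 4 → (Matrix n n ℂ)ˣ) (X₀ : Site 4 → Fin 4 → Matrix n n ℂ) (α₀ : ℝ) (m : Site 4 → Fin 4 → ℝ) (C : ℝ), IsSkewDir X₀ ∧ (∀ (hWu : IsUnitaryCfg Us) (hx : 0 ≤ ε / (((2 : ℕ) : ℝ) ^ (k + 1)) ^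 2) (hs : LevelSmall 4 2 k (ε / (((2 : ℕ) : ℝ) ^ (k + 1)) ^ 2)) (hWx : SmallField Us (ε / (((2 : ℕ) : ℝ) ^ (k + 1)) ^ 2)) (hθ : cruxC 4 2 * ((((2 : ℕ) : ℝ) ^ (k + 1)) ^ 2 * (ε / (((2 : ℕ) : ℝ) ^ (k + 1)) ^ 2)) < 1) (hφ : IsSkewDir (dirIter 2 (k + 1) Us X₀)), ResidualSliceRepT 2 N (k + 1) Us U' u X₀ (rightInvW (by norm_num) k hWu hx hs hWx N hθ hφ) α₀) ∧ (∀ z κ, 0 ≤ m z κ) ∧ 0 ≤ C ∧ (((2 : ℕ) : ℝ) ^ (k + 1)) ^ 4 * ∑ z ∈ periodBox (d := 4) N, ∑ κ : Fin 4, m z κ ^ 2 ≤ C ^ 2 * dirSq X₀ (periodBox (d := 4) (N * 2 ^ (k + 1))) ∧ (∀ z ∈ periodBox (d := 4) N, ∀ κ : Fin 4, ‖dirIter 2 (k + 1) Us X₀ z κ‖ ≤ C₂ * (((2 : ℕ) : ℝ) ^ (k + 1) * m z κ) ^ 2) ∧ α₀ * ((2 : ℕ) : ℝ) ^ (k + 1)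 ≤ αh ∧ (∀ z κ, m z κ * ((2 : ℕ) : ℝ) ^ (k + 1) ≤ αh) ∧ C ≤ Ch) →
    ∃ δV : ℝ, 0 < δV ∧
      ∀ V ∈ {V : Site 4 → Fin 4 → (Matrix n n ℂ)ˣ | IsUnitaryCfg V ∧ IsPeriodicCfg V (N : ℤ) ∧ SmallField V δV},
      ∀ k : ℕ, ∃ U : Site 4 → Fin 4 → (Matrix n n ℂ)ˣ, IsMinimiser 4 (sfClass 4 2 N ε) 2 N k V U ∧
        ∃ a : ℝ, 0 ≤ a ∧ a < ε / (((2 : ℕ) : ℝ) ^ k) ^ 2 ∧ SmallField U a := by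
  obtain ⟨ℓ, hℓ1, ε₀, hε₀, H⟩ := hint_of_plaqGrad_SU2 (n := n) hn (Cg := 2 * c₂ + 32 * c₀ * c₁ + 4 * c₀) (by positivity)
  have hεc : (0 : ℝ) < 1 / (5 * (c₀ + 1)) := by positivity
  refine ⟨ℓ, hℓ1, min ε₀ (1 / (5 * (c₀ + 1))), lt_min hε₀ hεc, fun ε hε hεle => ?_⟩
  obtain ⟨β₀, hβ₀, H2⟩ := H ε hε (hεle.trans (min_le_left _ _))
  have hβc : (0 : ℝ) < 1 / (32 * (c₀ + 1)) := by positivity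
  refine ⟨min β₀ (1 / (32 * (c₀ + 1))), lt_min hβ₀ hβc, ?_⟩
  intro β hβ hβle N _ C₂ αh Ch νh κh hN hC₂ hαh0 hαh1 hCh0 hνh hκh hν hline hREG hleaves
  have hβ1 : β ≤ 1 / (32 * (c₀ + 1)) := hβle.trans (min_le_right _ _)
  have hε1 : ε ≤ 1 / (5 * (c₀ + 1)) := hεle.trans (min_le_right _ _)
  -- the regime: `t ≤ 1` and `4ρ ≤ 1`
  have hc1 : (1 : ℝ) ≤ c₀ + 1 := by linarith
  have hβ2 : β ≤ 1 := hβ1.trans (by rw [div_le_one (by positivity)]; nlinarith)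
  have hexpβ : 4 * (Real.exp β - 1) ≤ 1 / (4 * (c₀ + 1)) := by
    have h := exp_sub_one_le_two_mul hβ.le hβ2
    have h2 : 8 * β ≤ 1 / (4 * (c₀ + 1)) := by
      rw [le_div_iff₀ (by positivity)] at hβ1 ⊢; nlinarith
    linarith
  have hεb : ε ≤ 1 / (5 * (c₀ + 1)) := hε1
  refine H2 β hβ (hβle.trans (min_le_left _ _)) N C₂ αh Ch νh κh hN hC₂ hαh0 hαh1 hCh0 hνh hκh hν hline ?_ hleaves
  -- (PG) from (REG9)
  intro D hDu hDP hDs k U hU hcrit r hr0 hr hUr q τ μ κ hκμ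
  obtain ⟨u, A, hu, hUA, hA0, hA1, hA2⟩ := hREG D hDu hDP hDs k U hU hcrit r hr0 hr hUr q
  have hUu : IsUnitaryCfg U := hU.1.1
  have hb := plaqGrad_of_regLetters hUu hUr hu q hUA hA0 hA1 hA2 τ κ μ hκμ
  refine hb.trans ?_
  -- arithmetic
  have hM1 : (1 : ℝ) ≤ ((2 : ℕ) : ℝ) ^ (k + 1) := by
    have : (1 : ℝ) ≤ ((2 : ℕ) : ℝ) := by norm_num
    exact one_le_pow₀ this
  have hβ' : 0 ≤ 4 * (Real.exp β - 1) := by nlinarith [Real.add_one_le_exp β]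
  have hr4 : r ≤ ε / 4 := by have e := hr; norm_num at e; linarith
  have hrt : r ≤ r + 4 * (Real.exp β - 1) + ε := by linarith
  have ht1 : r + 4 * (Real.exp β - 1) + ε ≤ 1 := by
    have h1 : (1 : ℝ) / (5 * (c₀ + 1)) ≤ 1 / 5 := by
      apply div_le_div_of_nonneg_left (by norm_num) (by norm_num); nlinarith
    have h2 : (1 : ℝ) / (4 * (c₀ + 1)) ≤ 1 / 4 := by
      apply div_le_div_of_nonneg_left (by norm_num) (by norm_num); nlinarith
    linarith
  have hρ : 4 * (c₀ * (r + 4 * (Real.exp β - 1) + ε) / ((2 : ℕ) : ℝ) ^ (k + 1)) ≤ 1 := by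
    have hM2 : (2 : ℝ) ≤ ((2 : ℕ) : ℝ) ^ (k + 1) := by
      have h : ((2 : ℕ) : ℝ) ^ 1 ≤ ((2 : ℕ) : ℝ) ^ (k + 1) := pow_le_pow_right₀ (by norm_num) (by omega)
      norm_num at h ⊢; exact h
    have e5 : (5 : ℝ) / 4 * (1 / (5 * (c₀ + 1))) = 1 / (4 * (c₀ + 1)) := by field_simp; try ring
    have ht2 : r + 4 * (Real.exp β - 1) + ε ≤ 1 / (2 * (c₀ + 1)) := by
      have h2 : 5 / 4 * ε ≤ 1 / (4 * (c₀ + 1)) := by rw [← e5]; exact mul_le_mul_of_nonneg_left hε1 (by norm_num)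
      have e6 : (1 : ℝ) / (4 * (c₀ + 1)) + 1 / (4 * (c₀ + 1)) = 1 / (2 * (c₀ + 1)) := by field_simp; try ring
      linarith
    have hct : c₀ * (r + 4 * (Real.exp β - 1) + ε) ≤ 1 / 2 := by
      have h3 := mul_le_mul_of_nonneg_left ht2 hc₀
      have h4 : c₀ * (1 / (2 * (c₀ + 1))) ≤ 1 / 2 := by
        rw [mul_one_div, div_le_iff₀ (by positivity)]; linarith
      linarith
    have hM0 : (0 : ℝ) < ((2 : ℕ) : ℝ) ^ (k + 1) := by positivity
    rw [show 4 * (c₀ * (r + 4 * (Real.exp β - 1) + ε) / ((2 : ℕ) : ℝ) ^ (k + 1)) = (4 * (c₀ * (r + 4 * (Real.exp β - 1) + ε))) / ((2 : ℕ) : ℝ) ^ (k + 1) by ring,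
      div_le_one hM0]
    linarith
  have h := plaqGrad_letters_bound (M := ((2 : ℕ) : ℝ) ^ (k + 1)) (c₂ := c₂) hM1 hc₀ hc₁ hr0 hrt ht1 hρ
  exact h

end

end Summit.QuantumFields.BalabanUV.T4Continuum.NE7HintOfRegLettersSU2
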